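import Mathlib
import HarnessLib
import Literature.Combinatorics.Additive.CriticalTrios

/-!
# The structures of Kemperman's theorem: `R`-sequences, beats and chords
# (Boothby–DeVos–Montejano §4, Definitions 4.1–4.4, and the converse half of the classification)

Topic `Literature/Combinatorics/Additive`.  Cell `mm-stpp` (D-0046), seat `mm-stpp-lit` (gen 13);
continuation of `CriticalTrios.lean` (S87: trios, `third`, `trioDeficiency`, `IsMaximalTrio`,
`IsPurePair`, `IsSubgroupCarrier`, `ClosureIs`, Kneser/Vosper for trios, beat stability, Mann,
purification), whose vocabulary is used throughout.

SOURCE.  T. Boothby, M. DeVos, A. Montejano, *A new proof of Kemperman's theorem*, Integers 15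
(2015) #A5 = arXiv:1301.0095, §4 "Critical trios" [cite: BoothbyDevosMontejano2013, §4].  For a
FINITE abelian group `G` and a finite subgroup `H` (a subgroup carrier `H : Finset G`) this file
types the four structures of KEMPERMAN'S STRUCTURE THEOREM (Thm 4.5 of the source) and proves what
the source calls immediate:

* `IsCyclicQuotGen H r` ("`G/H` is cyclic, generated by `R = r + H`": every element lies in some
  `i•r + H`) and `rseq H r a n = ⋃_{i<n} (a + i•r + H)` (an `R`-SEQUENCE with head `a + H` and
  `n` terms; "basic" = head `H`, "nontrivial" = `n ≥ 2`); the minimal period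
  `exists_minimal_nsmul_mem` (least `t ≥ 1` with `t•r ∈ H`, i.e. `[G : H]`), `rseq_eq_univ`
  (`t` consecutive cosets exhaust `G`), `card_rseq` (`n ≤ t` consecutive cosets are distinct:
  `|rseq| = n|H|`), `rseq_add_rseq` (`(a + [0,m)R) + (b + [0,n)R) = (a + b) + [0, m+n−1)R`),
  "a pair of `R`-sequences will be critical" `card_rseq_add_rseq_add_card_le`, and
  `addStab_rseq` (a proper nonempty `R`-sequence has stabilizer exactly `H`).
* **Definition 4.1** `IsPureBeatAt H A B C` (`A = H`, `stab B = H`, `C = third A B ≠ ∅`),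
  **Definition 4.2** `IsPureChordAt H r A B C` (`A`, `B` nontrivial `R`-sequences,
  `C = third A B` not inside one `H`-coset), **Definition 4.3** `IsImpureBeatAt H A B C`
  (`[A] = H ⊇ A`, `B ∖ H` `H`-stable, `C ∖ H = third A B ∖ H`, `B ∩ H ≠ ∅ ≠ C ∩ H`),
  **Definition 4.4** `IsImpureChordAt H r A B C` (`H ∪ A`, `H ∪ B` nontrivial basic
  `R`-sequences, `C ∖ H = third A B ∖ H ≠ ∅`, `A ∩ H, B ∩ H, C ∩ H ≠ ∅`) — all in NORMAL
  POSITION; the relation `Similar` (compositions of permutations and translations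
  `(A + g, B − g, C)`, §4 first paragraph) with its invariance lemmas, and the four structures
  "relative to `H`" (`IsPureBeat H T` etc.: some trio similar to `T` is in normal position).
* The CONVERSE HALF of the classification: "every pure beat or pure chord relative to `H` is a
  maximal critical trio with deficiency `|H|`" — `IsPureBeatAt.isMaximalTrio`,
  `IsPureBeatAt.trioDeficiency_eq`, `IsPureChordAt.isMaximalTrio`,
  `IsPureChordAt.trioDeficiency_eq` (via Prop 3.4 / Thm 3.5 of S87); and for the impure structures
  the CONTINUATION `(A, B ∩ H, C ∩ H)` resp. `(A ∩ H, B ∩ H, C ∩ H)` "is a nontrivial trio in `H`"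
  with "`δ(A',B',C') = δ(A,B,C)`" (deficiency computed in `H`):
  `IsImpureBeatAt.continuation_isTrio/_subset/_nonempty/_deficiency` and
  `IsImpureChordAt.continuation_isTrio/_subset/_nonempty/_deficiency` (the chord case through the
  coset bookkeeping `IsImpureChordAt.add_sub_two_lt` — the lengths stay below the period `t`,
  `m + n − 2 < t` — `sdiff_eq_rseq_of_union_eq_rseq` (`A ∖ H = r + [0, m−1)R`),
  `IsImpureChordAt.add_sdiff_eq` (`(A + B) ∖ H = r + [0, m+n−2)R`) and `card_third_sdiff_add`
  (`|third A B ∖ H| + |(A + B) ∖ H| + |H| = |G|`)).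

* The remark "`(A',B',C')` will be maximal whenever `(A,B,C)` is maximal": maximality and
  deficiency RELATIVE TO an ambient set `K` (`IsMaximalTrioIn K A B C`, `trioDeficiencyIn K A B C`,
  with `isMaximalTrioIn_iff` — the third-set characterisation of §3 inside `K` — and
  `isMaximalTrioIn_univ_iff`/`trioDeficiencyIn_univ`), and
  `IsImpureBeatAt.continuation_isMaximalTrioIn`, `IsImpureChordAt.continuation_isMaximalTrioIn`
  (both through `inter_eq_inter_third_inter`: a representation `−x = p + q` of `−x ∈ H` has
  `p, q ∈ H` unless `p + H ⊆ P`, which would put `H ⊆ −(P + Q)`), packaged with nontriviality and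
  the deficiency identity as `IsImpureBeatAt.continuation` / `IsImpureChordAt.continuation`.
* The same statements for the similarity-closed (printed) notions: `IsPureBeat.isMaximalTrio`,
  `IsPureChord.isMaximalTrio` (maximal, critical, `δ = |H|`), `IsImpureBeat.exists_continuation`,
  `IsImpureChord.exists_continuation`, and `IsMaximalTrio.isPureBeat_or_isImpureBeat`.

NOT FORMALIZED here: Theorem 4.5 itself (the recursive classification: every maximal nontrivial
critical trio is an impure beat/chord with structured continuation, …, ending in a pure beat or
chord — §§7–8 of the source; its deeper levels need the four predicates relative to an ambient
subgroup `K` in place of `G`, or transport to `↥H`).  Everything here is PROVED (0 named facts);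
finite `G` only (`-- TODO(general form)`: the source allows infinite `G` with `H` finite and cofinite
members).  Census-silent for the cell `mm-stpp` (LIT-INDEX §11 (b)).

## References
* T. Boothby, M. DeVos, A. Montejano, *A new proof of Kemperman's theorem*, Integers 15 (2015)
  #A5, arXiv:1301.0095, §4 (Definitions 4.1–4.4, Theorem 4.5 and the remarks around them) — held
  `paper:arxiv-1301.0095`, chunks p0005–p0006 read 2026-08-28
  [cite: BoothbyDevosMontejano2013, Def 4.1; Def 4.2; Def 4.3; Def 4.4; §4].
* J. H. B. Kemperman, *On small sumsets in an abelian group*, Acta Math. 103 (1960) 63–88 (not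
  held; cited through the source).
-/

namespace Literature.Combinatorics.Additive

open Finset Grynkiewicz
open scoped Pointwise

variable {G : Type*} [AddCommGroup G] [DecidableEq G]

/-! ## `G/H` cyclic; `R`-sequences -/

/-- "`G/H` is a cyclic group generated by `R`", `R = r + H`: every element of `G` lies in a coset
`i•r + H`, `i ∈ ℕ`. [cite: BoothbyDevosMontejano2013, §4] -/
def IsCyclicQuotGen (H : Finset G) (r : G) : Prop := ∀ x : G, ∃ i : ℕ, x ∈ (i • r) +ᵥ H

/-- The `R`-SEQUENCE with head `a + H` and `n` terms: `⋃_{i < n} (a + i•r + H)` ("any set of the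
form `S = {A + iR ∣ 0 ≤ i ≤ k}` with `A ∈ G/H`"; here `n = k + 1` is the length, `a + H` the head,
`a + (n−1)•r + H` the tail; BASIC means `a ∈ H`, NONTRIVIAL means `n ≥ 2`).
[cite: BoothbyDevosMontejano2013, §4] -/
def rseq (H : Finset G) (r a : G) (n : ℕ) : Finset G :=
  (range n).biUnion fun i : ℕ => (a + i • r) +ᵥ H

section Seq

variable {H : Finset G} {r a b : G} {m n t : ℕ}

/-- Unfolding lemma. [cite: BoothbyDevosMontejano2013, §4] -/
theorem isCyclicQuotGen_iff : IsCyclicQuotGen H r ↔ ∀ x : G, ∃ i : ℕ, x ∈ (i • r) +ᵥ H := Iff.rfl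

/-- Unfolding lemma. [cite: BoothbyDevosMontejano2013, §4] -/
theorem rseq_def (H : Finset G) (r a : G) (n : ℕ) :
    rseq H r a n = (range n).biUnion fun i : ℕ => (a + i • r) +ᵥ H := rfl

/-- Membership in an `R`-sequence. [cite: BoothbyDevosMontejano2013, §4] -/
theorem mem_rseq {x : G} : x ∈ rseq H r a n ↔ ∃ i, i < n ∧ x ∈ (a + i • r) +ᵥ H := by
  rw [rseq, mem_biUnion]; simp only [mem_range]

/-- The empty sequence. [cite: BoothbyDevosMontejano2013, §4] -/
theorem rseq_zero (H : Finset G) (r a : G) : rseq H r a 0 = ∅ := by simp [rseq]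

/-- A one-term sequence is a coset. [cite: BoothbyDevosMontejano2013, §4] -/
theorem rseq_one (H : Finset G) (r a : G) : rseq H r a 1 = a +ᵥ H := by
  simp [rseq]

/-- Sequences grow with the length. [cite: BoothbyDevosMontejano2013, §4] -/
theorem rseq_mono (H : Finset G) (r a : G) (h : m ≤ n) : rseq H r a m ⊆ rseq H r a n := by
  intro x hx
  rw [mem_rseq] at hx ⊢
  obtain ⟨i, hi, hx⟩ := hx
  exact ⟨i, lt_of_lt_of_le hi h, hx⟩

/-- Each term lies in the sequence. [cite: BoothbyDevosMontejano2013, §4] -/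
theorem coset_subset_rseq (H : Finset G) (r a : G) {i : ℕ} (hi : i < n) :
    (a + i • r) +ᵥ H ⊆ rseq H r a n := fun _ hx => mem_rseq.2 ⟨i, hi, hx⟩

/-- Translating a sequence translates its head. [cite: BoothbyDevosMontejano2013, §4] -/
theorem vadd_rseq (g : G) (H : Finset G) (r a : G) (n : ℕ) :
    g +ᵥ rseq H r a n = rseq H r (g + a) n := by
  unfold rseq
  rw [← image_vadd, biUnion_image]
  refine biUnion_congr rfl fun i _ => ?_
  rw [image_vadd, vadd_vadd, add_assoc]

/-- `|rseq H r a n| ≤ n|H|`. [cite: BoothbyDevosMontejano2013, §4] -/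
theorem card_rseq_le (H : Finset G) (r a : G) (n : ℕ) : #(rseq H r a n) ≤ n * #H := by
  calc #(rseq H r a n) ≤ ∑ i ∈ range n, #((a + i • r) +ᵥ H) := card_biUnion_le
    _ = n * #H := by simp [card_vadd_finset]

/-- An `R`-sequence is `H`-stable. [cite: BoothbyDevosMontejano2013, §4] -/
theorem rseq_add (hH : IsSubgroupCarrier H) (r a : G) (n : ℕ) :
    rseq H r a n + H = rseq H r a n := by
  refine Subset.antisymm ?_ (hH.subset_add _)
  intro y hy
  obtain ⟨x, hx, h, hh, rfl⟩ := mem_add.1 hy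
  rw [mem_rseq] at hx ⊢
  obtain ⟨i, hi, hx⟩ := hx
  refine ⟨i, hi, ?_⟩
  rw [hH.mem_coset_iff] at hx ⊢
  have e : x + h - (a + i • r) = (x - (a + i • r)) + h := by abel
  rw [e]; exact hH.add_mem hx hh

/-- The sum of two `R`-sequences: `(a + [0,m)R) + (b + [0,n)R) = (a + b) + [0, m + n − 1)R` for
`m, n ≥ 1`. [cite: BoothbyDevosMontejano2013, §4] -/
theorem rseq_add_rseq (hH : IsSubgroupCarrier H) (r a b : G) (hm : 1 ≤ m) (hn : 1 ≤ n) :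
    rseq H r a m + rseq H r b n = rseq H r (a + b) (m + n - 1) := by
  ext x
  constructor
  · intro hx
    obtain ⟨y, hy, z, hz, rfl⟩ := mem_add.1 hx
    rw [mem_rseq] at hy hz ⊢
    obtain ⟨i, hi, hy⟩ := hy
    obtain ⟨j, hj, hz⟩ := hz
    refine ⟨i + j, by omega, ?_⟩
    rw [hH.mem_coset_iff] at hy hz ⊢
    have e : y + z - (a + b + (i + j) • r) = (y - (a + i • r)) + (z - (b + j • r)) := by
      rw [add_nsmul]; abel
    rw [e]; exact hH.add_mem hy hz
  · intro hx
    rw [mem_rseq] at hx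
    obtain ⟨s, hs, hx⟩ := hx
    rw [hH.mem_coset_iff] at hx
    -- split `s = i + j` with `i < m`, `j < n`
    obtain ⟨i, j, hi, hj, rfl⟩ : ∃ i j, i < m ∧ j < n ∧ s = i + j :=
      ⟨min s (m - 1), s - min s (m - 1), by omega, by omega, by omega⟩
    refine mem_add.2 ⟨a + i • r, coset_subset_rseq H r a hi (hH.mem_coset_self _),
      x - (a + i • r), coset_subset_rseq H r b hj ?_, by abel⟩
    rw [hH.mem_coset_iff]
    have e : x - (a + i • r) - (b + j • r) = x - (a + b + (i + j) • r) := by rw [add_nsmul]; abel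
    rw [e]; exact hx

/-- "It is easy to see that a pair of `R`-sequences will be critical": for `m, n ≥ 1`,
`|A + B| + |H| ≤ |A| + |B|` whenever `|A| = m|H|`, `|B| = n|H|` (the sum has at most `m + n − 1`
cosets). [cite: BoothbyDevosMontejano2013, §4] -/
theorem card_rseq_add_rseq_add_card_le (hH : IsSubgroupCarrier H) (r a b : G) (hm : 1 ≤ m)
    (hn : 1 ≤ n) (hA : #(rseq H r a m) = m * #H) (hB : #(rseq H r b n) = n * #H) :
    #(rseq H r a m + rseq H r b n) + #H ≤ #(rseq H r a m) + #(rseq H r b n) := by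
  rw [rseq_add_rseq hH r a b hm hn, hA, hB]
  have := card_rseq_le H r (a + b) (m + n - 1)
  have e : (m + n - 1) * #H + #H = m * #H + n * #H := by
    rw [← Nat.succ_mul, show (m + n - 1).succ = m + n by omega, add_mul]
  omega

variable [Fintype G]

omit [Fintype G] [DecidableEq G] in
/-- Multiples of a period are periods: `t•r ∈ H ⇒ (t·q)•r ∈ H`. [cite: BoothbyDevosMontejano2013, §4] -/
theorem IsSubgroupCarrier.mul_nsmul_mem (hH : IsSubgroupCarrier H) (htH : t • r ∈ H) (q : ℕ) :
    (t * q) • r ∈ H := by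
  induction q with
  | zero => rw [mul_zero, zero_nsmul]; exact hH.zero_mem
  | succ k ih => rw [Nat.mul_succ, add_nsmul]; exact hH.add_mem ih htH

/-- In a finite group some positive multiple of `r` lies in `H`, and there is a LEAST such `t ≥ 1`
(the order of `r + H` in `G/H`, i.e. `[G : H]` when `r + H` generates). [cite: BoothbyDevosMontejano2013, §4] -/
theorem exists_minimal_nsmul_mem (hH : IsSubgroupCarrier H) (r : G) :
    ∃ t : ℕ, 0 < t ∧ t • r ∈ H ∧ ∀ s : ℕ, 0 < s → s < t → s • r ∉ H := by
  classical
  have hex : ∃ t : ℕ, 0 < t ∧ t • r ∈ H :=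
    ⟨addOrderOf r, addOrderOf_pos r, by rw [addOrderOf_nsmul_eq_zero]; exact hH.zero_mem⟩
  refine ⟨Nat.find hex, (Nat.find_spec hex).1, (Nat.find_spec hex).2, fun s hs hst hsH => ?_⟩
  exact Nat.find_min hex hst ⟨hs, hsH⟩

/-- With `t` the least positive multiple of `r` in `H` and `r + H` generating `G/H`: the `t`
consecutive cosets starting anywhere exhaust `G`. [cite: BoothbyDevosMontejano2013, §4] -/
theorem rseq_eq_univ (hH : IsSubgroupCarrier H) (hgen : IsCyclicQuotGen H r) (ht : 0 < t)
    (htH : t • r ∈ H) (a : G) : rseq H r a t = univ := by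
  refine eq_univ_of_forall fun x => ?_
  obtain ⟨i, hi⟩ := hgen (x - a)
  rw [mem_rseq]
  refine ⟨i % t, Nat.mod_lt i ht, ?_⟩
  rw [hH.mem_coset_iff] at hi ⊢
  have hdiv : (t * (i / t)) • r ∈ H := hH.mul_nsmul_mem htH (i / t)
  have hi' : i • r = (i % t) • r + (t * (i / t)) • r := by rw [← add_nsmul, Nat.mod_add_div]
  have e : x - (a + (i % t) • r) = (x - a - i • r) + (t * (i / t)) • r := by rw [hi']; abel
  rw [e]; exact hH.add_mem hi hdiv

/-- Hence `|G| ≤ t|H|`. [cite: BoothbyDevosMontejano2013, §4] -/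
theorem card_univ_le_of_minimal (hH : IsSubgroupCarrier H) (hgen : IsCyclicQuotGen H r)
    (ht : 0 < t) (htH : t • r ∈ H) : Fintype.card G ≤ t * #H := by
  rw [← card_univ, ← rseq_eq_univ hH hgen ht htH 0]
  exact card_rseq_le H r 0 t

omit [Fintype G] in
/-- Consecutive cosets below the minimal period are pairwise distinct (indeed disjoint).
[cite: BoothbyDevosMontejano2013, §4] -/
theorem disjoint_coset_of_lt (hH : IsSubgroupCarrier H) (hmin : ∀ s : ℕ, 0 < s → s < t → s • r ∉ H)
    (a : G) {i j : ℕ} (hij : i < j) (hj : j < t) :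
    Disjoint ((a + i • r) +ᵥ H) ((a + j • r) +ᵥ H) := by
  rcases hH.coset_eq_or_disjoint (a + i • r) (a + j • r) with heq | hdis
  · exfalso
    have hmem : a + j • r ∈ (a + i • r) +ᵥ H := heq ▸ hH.mem_coset_self _
    rw [hH.mem_coset_iff] at hmem
    have h2 : j • r = i • r + (j - i) • r := by rw [← add_nsmul]; congr 1; omega
    have e : a + j • r - (a + i • r) = (j - i) • r := by rw [h2]; abel
    rw [e] at hmem
    exact hmin (j - i) (by omega) (by omega) hmem
  · exact hdis

omit [Fintype G] in
/-- `n ≤ t` consecutive cosets have `n|H|` elements. [cite: BoothbyDevosMontejano2013, §4] -/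
theorem card_rseq (hH : IsSubgroupCarrier H) (hmin : ∀ s : ℕ, 0 < s → s < t → s • r ∉ H) (a : G)
    (hn : n ≤ t) : #(rseq H r a n) = n * #H := by
  rw [rseq, card_biUnion]
  · simp [card_vadd_finset]
  · intro i hi j hj hij
    rw [mem_coe, mem_range] at hi hj
    rcases lt_or_gt_of_ne hij with h | h
    · exact disjoint_coset_of_lt hH hmin a h (lt_of_lt_of_le hj hn)
    · exact (disjoint_coset_of_lt hH hmin a h (lt_of_lt_of_le hi hn)).symm

/-- `|G| = t|H|` (`t = [G : H]`). [cite: BoothbyDevosMontejano2013, §4] -/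
theorem card_univ_eq_of_minimal (hH : IsSubgroupCarrier H) (hgen : IsCyclicQuotGen H r) (ht : 0 < t)
    (htH : t • r ∈ H) (hmin : ∀ s : ℕ, 0 < s → s < t → s • r ∉ H) :
    Fintype.card G = t * #H := by
  rw [← card_univ, ← rseq_eq_univ hH hgen ht htH 0, card_rseq hH hmin 0 le_rfl]

/-- A proper `R`-sequence (`≠ G`) has fewer than `t` terms, hence exactly `n|H|` elements.
[cite: BoothbyDevosMontejano2013, §4] -/
theorem lt_of_rseq_ne_univ (hH : IsSubgroupCarrier H) (hgen : IsCyclicQuotGen H r) (ht : 0 < t)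
    (htH : t • r ∈ H) (hne : rseq H r a n ≠ univ) : n < t := by
  by_contra h
  exact hne (eq_univ_of_forall fun x => rseq_mono H r a (not_lt.1 h)
    (by rw [rseq_eq_univ hH hgen ht htH a]; exact mem_univ x))

/-- **The stabilizer of a proper nonempty `R`-sequence is exactly `H`** (so `R`-sequences are
`H`-stable but not more; the purity behind "every pure chord is a maximal critical trio").  Proof:
`x ∈ stab S` lies in some `j•r + H`; reducing `j` modulo the period `t` we may take `0 < j < t`
(else `x ∈ H`); the term `a + i•r + H` with `i = max(0, n − j)` is moved by `j•r` onto
`a + (i + j)•r + H` with `n ≤ i + j < t`, outside `S`. [cite: BoothbyDevosMontejano2013, §4] -/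
theorem addStab_rseq (hH : IsSubgroupCarrier H) (hgen : IsCyclicQuotGen H r) (hn : 1 ≤ n)
    (hne : rseq H r a n ≠ univ) : (rseq H r a n).addStab = H := by
  obtain ⟨t, ht, htH, hmin⟩ := exists_minimal_nsmul_mem hH r
  have hnt : n < t := lt_of_rseq_ne_univ hH hgen ht htH hne
  set S := rseq H r a n with hSdef
  have hSne : S.Nonempty := ⟨a + 0 • r, coset_subset_rseq H r a (i := 0) hn (hH.mem_coset_self _)⟩
  refine Subset.antisymm ?_ ((hH.add_eq_self_iff_subset_addStab hSne).1 (rseq_add hH r a n))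
  intro x hx
  by_contra hxH
  -- `x ∈ j•r + H`; reduce `j` mod `t`
  obtain ⟨j₀, hj₀⟩ := hgen x
  set j := j₀ % t with hjdef
  have hjt : j < t := Nat.mod_lt j₀ ht
  have hxj : x ∈ (j • r) +ᵥ H := by
    rw [hH.mem_coset_iff] at hj₀ ⊢
    have hdiv : (t * (j₀ / t)) • r ∈ H := hH.mul_nsmul_mem htH (j₀ / t)
    have hj' : j₀ • r = j • r + (t * (j₀ / t)) • r := by rw [hjdef, ← add_nsmul, Nat.mod_add_div]
    have e : x - j • r = (x - j₀ • r) + (t * (j₀ / t)) • r := by rw [hj']; abel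
    rw [e]; exact hH.add_mem hj₀ hdiv
  have hj0 : 0 < j := by
    rcases Nat.eq_zero_or_pos j with h | h
    · rw [h, zero_nsmul] at hxj
      exact (hxH (by rw [hH.mem_coset_iff, sub_zero] at hxj; exact hxj)).elim
    · exact h
  -- `j•r` itself stabilizes `S` (as `x = j•r + h` with `h ∈ H ⊆ stab S`)
  have hstabH : H ⊆ S.addStab := (hH.add_eq_self_iff_subset_addStab hSne).1 (rseq_add hH r a n)
  have hjr : j • r ∈ S.addStab := by
    have hxh : x - j • r ∈ H := (hH.mem_coset_iff).1 hxj
    have := sub_mem_addStab hx (hstabH hxh)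
    rwa [sub_sub_cancel] at this
  -- the term `i = max 0 (n - j)` is pushed out of `S`
  set i := n - j with hidef
  have hi : i < n := by omega
  have hij : n ≤ i + j := by omega
  have hijt : i + j < t := by omega
  have hmem : a + i • r ∈ S := coset_subset_rseq H r a hi (hH.mem_coset_self _)
  have hmoved : j • r + (a + i • r) ∈ S := by
    have h := (mem_addStab hSne).1 hjr
    rw [← h]; exact (vadd_mem_vadd_finset_iff (j • r)).2 hmem
  rw [hSdef, mem_rseq] at hmoved
  obtain ⟨k, hk, hmk⟩ := hmoved
  rw [hH.mem_coset_iff] at hmk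
  -- `(i + j - k) • r ∈ H` with `0 < i + j - k < t`
  have hlt : k < i + j := by omega
  have h2 : (i + j) • r = k • r + (i + j - k) • r := by rw [← add_nsmul]; congr 1; omega
  have e : j • r + (a + i • r) - (a + k • r) = (i + j - k) • r := by
    calc j • r + (a + i • r) - (a + k • r) = (i + j) • r - k • r := by rw [add_nsmul]; abel
      _ = (i + j - k) • r := by rw [h2]; abel
  rw [e] at hmk
  exact hmin (i + j - k) (by omega) (by omega) hmk

end Seq


/-! ## Similar trios (§4, first paragraph) -/

/-- "We say that two trios are SIMILAR if one can be turned into the other by a sequence of these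
operations" — permutations of the three sets and the translations `(A + g, B − g, C)`.  Here:
`Similar T U` = `U` is reachable from `T`. [cite: BoothbyDevosMontejano2013, §4] -/
inductive Similar : Finset G × Finset G × Finset G → Finset G × Finset G × Finset G → Prop
  | refl (T : Finset G × Finset G × Finset G) : Similar T T
  | rotate {T : Finset G × Finset G × Finset G} {A B C : Finset G} :
      Similar T (A, B, C) → Similar T (B, C, A)
  | swap {T : Finset G × Finset G × Finset G} {A B C : Finset G} :
      Similar T (A, B, C) → Similar T (B, A, C)
  | translate {T : Finset G × Finset G × Finset G} {A B C : Finset G} (g : G) :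
      Similar T (A, B, C) → Similar T (g +ᵥ A, -g +ᵥ B, C)

section SimilarLemmas

variable {A B C A' B' C' : Finset G}

/-- Maximality is invariant under the translation `(A + g, B − g, C)`.
[cite: BoothbyDevosMontejano2013, §4] -/
theorem IsMaximalTrio.translate (h : IsMaximalTrio A B C) (g : G) :
    IsMaximalTrio (g +ᵥ A) (-g +ᵥ B) C :=
  (h.rotate.rotate.translate_right g).rotate

/-- Similar triples are trios together ("these operations preserve nontriviality, maximality,
criticality, and deficiency"). [cite: BoothbyDevosMontejano2013, §4] -/
theorem Similar.isTrio_iff (h : Similar (A, B, C) (A', B', C')) : IsTrio A B C ↔ IsTrio A' B' C' := by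
  generalize hT : (A, B, C) = T at h
  generalize hU : (A', B', C') = U at h
  induction h generalizing A' B' C' with
  | refl => cases hT; cases hU; exact Iff.rfl
  | rotate _ ih =>
      cases hU
      exact (ih rfl).trans isTrio_rotate
  | swap _ ih =>
      cases hU
      exact (ih rfl).trans isTrio_comm
  | translate g _ ih =>
      cases hU
      refine (ih rfl).trans ⟨fun h => h.translate g, fun h => ?_⟩
      have := h.translate (-g)
      rwa [neg_neg, ← add_vadd, neg_add_cancel, zero_vadd, ← add_vadd, add_neg_cancel, zero_vadd]
        at this

/-- Similar triples are maximal trios together. [cite: BoothbyDevosMontejano2013, §4] -/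
theorem Similar.isMaximalTrio_iff (h : Similar (A, B, C) (A', B', C')) :
    IsMaximalTrio A B C ↔ IsMaximalTrio A' B' C' := by
  generalize hT : (A, B, C) = T at h
  generalize hU : (A', B', C') = U at h
  induction h generalizing A' B' C' with
  | refl => cases hT; cases hU; exact Iff.rfl
  | rotate _ ih =>
      cases hU
      exact (ih rfl).trans ⟨IsMaximalTrio.rotate, fun h => h.rotate.rotate⟩
  | swap _ ih =>
      cases hU
      exact (ih rfl).trans ⟨IsMaximalTrio.swap, IsMaximalTrio.swap⟩
  | translate g _ ih =>
      cases hU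
      refine (ih rfl).trans ⟨fun h => h.translate g, fun h => ?_⟩
      have := h.translate (-g)
      rwa [neg_neg, ← add_vadd, neg_add_cancel, zero_vadd, ← add_vadd, add_neg_cancel, zero_vadd]
        at this

/-- Similar triples have all members nonempty together ("nontriviality").
[cite: BoothbyDevosMontejano2013, §4] -/
theorem Similar.nonempty_iff (h : Similar (A, B, C) (A', B', C')) :
    (A.Nonempty ∧ B.Nonempty ∧ C.Nonempty) ↔ (A'.Nonempty ∧ B'.Nonempty ∧ C'.Nonempty) := by
  generalize hT : (A, B, C) = T at h
  generalize hU : (A', B', C') = U at h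
  induction h generalizing A' B' C' with
  | refl => cases hT; cases hU; exact Iff.rfl
  | rotate _ ih =>
      cases hU
      exact (ih rfl).trans ⟨fun h => ⟨h.2.1, h.2.2, h.1⟩, fun h => ⟨h.2.2, h.1, h.2.1⟩⟩
  | swap _ ih =>
      cases hU
      exact (ih rfl).trans ⟨fun h => ⟨h.2.1, h.1, h.2.2⟩, fun h => ⟨h.2.1, h.1, h.2.2⟩⟩
  | translate g _ ih =>
      cases hU
      exact (ih rfl).trans ⟨fun h => ⟨h.1.vadd_finset, h.2.1.vadd_finset, h.2.2⟩,
        fun h => ⟨(vadd_finset_nonempty).1 h.1, (vadd_finset_nonempty).1 h.2.1, h.2.2⟩⟩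

variable [Fintype G]

/-- Similar triples have the same deficiency. [cite: BoothbyDevosMontejano2013, §4] -/
theorem Similar.trioDeficiency_eq (h : Similar (A, B, C) (A', B', C')) :
    trioDeficiency A B C = trioDeficiency A' B' C' := by
  generalize hT : (A, B, C) = T at h
  generalize hU : (A', B', C') = U at h
  induction h generalizing A' B' C' with
  | refl => cases hT; cases hU; rfl
  | rotate _ ih => cases hU; rw [ih rfl]; exact (trioDeficiency_rotate _ _ _).symm
  | swap _ ih => cases hU; rw [ih rfl]; exact (trioDeficiency_swap _ _ _).symm
  | translate g _ ih =>
      cases hU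
      rw [ih rfl, ← trioDeficiency_translate _ _ _ g (-g) 0, zero_vadd]

end SimilarLemmas

/-! ## Definitions 4.1–4.4 -/

section Defs

variable [Fintype G]

/-- **Definition 4.1 (pure beat), normal position.**  "`Υ` is a pure beat relative to `H` if `Υ`
is similar to a trio `(A,B,C)` which satisfies `A = H`, `G_B = H`, and
`C = \overline{−(A+B)} ≠ ∅`" — this is the predicate on the normal-position triple `(A,B,C)`.
[cite: BoothbyDevosMontejano2013, Def 4.1] -/
def IsPureBeatAt (H A B C : Finset G) : Prop :=
  A = H ∧ B.addStab = H ∧ C = third A B ∧ C.Nonempty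

/-- **Definition 4.2 (pure chord), normal position.**  "`Υ` is a pure chord relative to `H` if there
exists `R ∈ G/H` which generates `G/H` and a trio `(A,B,C)` similar to `Υ` for which `A`, `B` are
nontrivial `R`-sequences and `C = \overline{−(A+B)}` is not contained in a single `H`-coset" — the
predicate on `(A,B,C)` for the generator `r + H`. [cite: BoothbyDevosMontejano2013, Def 4.2] -/
def IsPureChordAt (H : Finset G) (r : G) (A B C : Finset G) : Prop :=
  IsCyclicQuotGen H r ∧ (∃ a : G, ∃ m : ℕ, 2 ≤ m ∧ A = rseq H r a m) ∧
    (∃ b : G, ∃ n : ℕ, 2 ≤ n ∧ B = rseq H r b n) ∧ C = third A B ∧ ∀ c : G, ¬ C ⊆ c +ᵥ H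

/-- **Definition 4.3 (impure beat), normal position.**  "`Υ` is an impure beat relative to `H < G`
if there is a trio `(A,B,C)` similar to `Υ` for which `[A] = H`, `B ∖ H` is `H`-stable,
`C ∖ H = \overline{−(A+B)} ∖ H`, and `B ∩ H ≠ ∅` and `C ∩ H ≠ ∅`.  In this case
`(A, B ∩ H, C ∩ H)` is a trio in `H` which we call a CONTINUATION of `Υ`."
[cite: BoothbyDevosMontejano2013, Def 4.3] -/
def IsImpureBeatAt (H A B C : Finset G) : Prop :=
  A ⊆ H ∧ ClosureIs H A ∧ B \ H + H = B \ H ∧ C \ H = third A B \ H ∧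
    (B ∩ H).Nonempty ∧ (C ∩ H).Nonempty

/-- **Definition 4.4 (impure chord), normal position.**  "`Υ` is an impure chord relative to `H` if
there exists `R ∈ G/H` which generates `G/H` and a trio `(A,B,C)` similar to `Υ` satisfying:
`H ∪ A` and `H ∪ B` are nontrivial basic `R`-sequences, `C ∖ H = \overline{−(A+B)} ∖ H ≠ ∅`, and
`A ∩ H`, `B ∩ H`, and `C ∩ H` are all nonempty.  As above, `(A ∩ H, B ∩ H, C ∩ H)` is a trio in
`H` which we call a CONTINUATION of `Υ`." [cite: BoothbyDevosMontejano2013, Def 4.4] -/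
def IsImpureChordAt (H : Finset G) (r : G) (A B C : Finset G) : Prop :=
  IsCyclicQuotGen H r ∧ (∃ m : ℕ, 2 ≤ m ∧ H ∪ A = rseq H r 0 m) ∧
    (∃ n : ℕ, 2 ≤ n ∧ H ∪ B = rseq H r 0 n) ∧ C \ H = third A B \ H ∧ (C \ H).Nonempty ∧
    (A ∩ H).Nonempty ∧ (B ∩ H).Nonempty ∧ (C ∩ H).Nonempty

/-- A trio is a PURE BEAT relative to `H` if it is similar to one in normal position.
[cite: BoothbyDevosMontejano2013, Def 4.1] -/
def IsPureBeat (H : Finset G) (T : Finset G × Finset G × Finset G) : Prop :=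
  ∃ A B C : Finset G, IsPureBeatAt H A B C ∧ Similar (A, B, C) T

/-- A trio is a PURE CHORD relative to `H` if, for some generator `r + H` of `G/H`, it is similar to
one in normal position. [cite: BoothbyDevosMontejano2013, Def 4.2] -/
def IsPureChord (H : Finset G) (T : Finset G × Finset G × Finset G) : Prop :=
  ∃ r : G, ∃ A B C : Finset G, IsPureChordAt H r A B C ∧ Similar (A, B, C) T

/-- A trio is an IMPURE BEAT relative to `H` if it is similar to one in normal position (whose
continuation is then `(A, B ∩ H, C ∩ H)`). [cite: BoothbyDevosMontejano2013, Def 4.3] -/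
def IsImpureBeat (H : Finset G) (T : Finset G × Finset G × Finset G) : Prop :=
  ∃ A B C : Finset G, IsImpureBeatAt H A B C ∧ Similar (A, B, C) T

/-- A trio is an IMPURE CHORD relative to `H` if, for some generator `r + H` of `G/H`, it is similar
to one in normal position (continuation `(A ∩ H, B ∩ H, C ∩ H)`). [cite: BoothbyDevosMontejano2013, Def 4.4] -/
def IsImpureChord (H : Finset G) (T : Finset G × Finset G × Finset G) : Prop :=
  ∃ r : G, ∃ A B C : Finset G, IsImpureChordAt H r A B C ∧ Similar (A, B, C) T

variable {H A B C : Finset G} {r : G}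

/-- Unfolding lemma. [cite: BoothbyDevosMontejano2013, Def 4.1] -/
theorem isPureBeatAt_iff : IsPureBeatAt H A B C ↔
    A = H ∧ B.addStab = H ∧ C = third A B ∧ C.Nonempty := Iff.rfl

/-- Unfolding lemma. [cite: BoothbyDevosMontejano2013, Def 4.2] -/
theorem isPureChordAt_iff : IsPureChordAt H r A B C ↔
    IsCyclicQuotGen H r ∧ (∃ a : G, ∃ m : ℕ, 2 ≤ m ∧ A = rseq H r a m) ∧
    (∃ b : G, ∃ n : ℕ, 2 ≤ n ∧ B = rseq H r b n) ∧ C = third A B ∧ ∀ c : G, ¬ C ⊆ c +ᵥ H :=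
  Iff.rfl

/-- Unfolding lemma. [cite: BoothbyDevosMontejano2013, Def 4.3] -/
theorem isImpureBeatAt_iff : IsImpureBeatAt H A B C ↔
    A ⊆ H ∧ ClosureIs H A ∧ B \ H + H = B \ H ∧ C \ H = third A B \ H ∧
    (B ∩ H).Nonempty ∧ (C ∩ H).Nonempty := Iff.rfl

/-- Unfolding lemma. [cite: BoothbyDevosMontejano2013, Def 4.4] -/
theorem isImpureChordAt_iff : IsImpureChordAt H r A B C ↔
    IsCyclicQuotGen H r ∧ (∃ m : ℕ, 2 ≤ m ∧ H ∪ A = rseq H r 0 m) ∧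
    (∃ n : ℕ, 2 ≤ n ∧ H ∪ B = rseq H r 0 n) ∧ C \ H = third A B \ H ∧ (C \ H).Nonempty ∧
    (A ∩ H).Nonempty ∧ (B ∩ H).Nonempty ∧ (C ∩ H).Nonempty := Iff.rfl

/-- Unfolding lemma. [cite: BoothbyDevosMontejano2013, Def 4.1] -/
theorem isPureBeat_iff {T : Finset G × Finset G × Finset G} :
    IsPureBeat H T ↔ ∃ A B C : Finset G, IsPureBeatAt H A B C ∧ Similar (A, B, C) T := Iff.rfl

/-- Unfolding lemma. [cite: BoothbyDevosMontejano2013, Def 4.2] -/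
theorem isPureChord_iff {T : Finset G × Finset G × Finset G} :
    IsPureChord H T ↔ ∃ r : G, ∃ A B C : Finset G, IsPureChordAt H r A B C ∧ Similar (A, B, C) T :=
  Iff.rfl

/-- Unfolding lemma. [cite: BoothbyDevosMontejano2013, Def 4.3] -/
theorem isImpureBeat_iff {T : Finset G × Finset G × Finset G} :
    IsImpureBeat H T ↔ ∃ A B C : Finset G, IsImpureBeatAt H A B C ∧ Similar (A, B, C) T := Iff.rfl

/-- Unfolding lemma. [cite: BoothbyDevosMontejano2013, Def 4.4] -/
theorem isImpureChord_iff {T : Finset G × Finset G × Finset G} :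
    IsImpureChord H T ↔
      ∃ r : G, ∃ A B C : Finset G, IsImpureChordAt H r A B C ∧ Similar (A, B, C) T := Iff.rfl

/-- Beat stability (S87, Lemma 5.3) in this vocabulary: a maximal critical trio with nonempty
members and `A ⊆ H = [A]` is a pure beat in normal position or an impure beat relative to `H`
(similar, by one translation of `(B, C)`, to one in normal position).
[cite: BoothbyDevosMontejano2013, Lemma 5.3] -/
theorem IsMaximalTrio.isPureBeatAt_or_isImpureBeat (h : IsMaximalTrio A B C)
    (hδ : 0 < trioDeficiency A B C) (hA : A.Nonempty) (hB : B.Nonempty) (hC : C.Nonempty)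
    (hH : IsSubgroupCarrier H) (hcl : ClosureIs H A) (hAH : A ⊆ H) :
    IsPureBeatAt H A B C ∨ IsImpureBeat H (A, B, C) := by
  rcases h.pureBeat_or_impureBeat hδ hA hB hC hH hcl hAH with ⟨hAeq, hBst, -, hCeq⟩ | ⟨g, h1, h2, h3, h4⟩
  · exact Or.inl ⟨hAeq, hBst, hCeq, hC⟩
  · refine Or.inr ⟨A, g +ᵥ B, -g +ᵥ C, ⟨hAH, hcl, h1, h2, h3, h4⟩, ?_⟩
    have := (Similar.refl (A, g +ᵥ B, -g +ᵥ C)).rotate.translate (-g)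
    rw [← add_vadd, neg_add_cancel, zero_vadd, neg_neg, ← add_vadd, add_neg_cancel, zero_vadd] at this
    exact this.rotate.rotate

end Defs


/-! ## The converse half: pure beats and pure chords are maximal critical trios of deficiency `|H|` -/

section Converse

variable [Fintype G] {H A B C : Finset G} {r : G}

omit [Fintype G] in
/-- An `R`-sequence with at least one term is nonempty. [cite: BoothbyDevosMontejano2013, §4] -/
theorem rseq_nonempty (hH : IsSubgroupCarrier H) (r a : G) {n : ℕ} (hn : 1 ≤ n) :
    (rseq H r a n).Nonempty :=
  ⟨a + 0 • r, coset_subset_rseq H r a (i := 0) hn (hH.mem_coset_self _)⟩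

/-- **"Every pure beat relative to `H` is a maximal critical trio"** (remark after Definition 4.2):
in normal position `(H, B)` is a pure critical pair (`H + B = B`, `|H + B| = |B| < |H| + |B|`) and
`C = third H B`, so Proposition 3.4 applies. [cite: BoothbyDevosMontejano2013, §4] -/
theorem IsPureBeatAt.isMaximalTrio (hH : IsSubgroupCarrier H) (h : IsPureBeatAt H A B C) :
    IsMaximalTrio A B C ∧ 0 < trioDeficiency A B C := by
  obtain ⟨hAeq, hBst, hCeq, hC⟩ := h
  subst hAeq
  have hB : B.Nonempty := Nonempty.of_addStab (by rw [hBst]; exact hH.nonempty)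
  have hBH : B + A = B := (hH.add_eq_self_iff_subset_addStab hB).2 (subset_of_eq hBst.symm)
  have hHB : A + B = B := by rw [add_comm]; exact hBH
  have hP : IsPurePair A B := ⟨by rw [hHB, hBst, hH.addStab_eq], by rw [hHB]⟩
  have hcrit : #(A + B) < #A + #B := by rw [hHB]; have := hH.nonempty.card_pos; omega
  exact (purePair_critical_iff_maximalTrio hH.nonempty hB).1 ⟨hP, hcrit, hCeq⟩

/-- **"… with deficiency `|H|`"** (pure beat). [cite: BoothbyDevosMontejano2013, §4] -/
theorem IsPureBeatAt.trioDeficiency_eq (hH : IsSubgroupCarrier H) (h : IsPureBeatAt H A B C) :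
    trioDeficiency A B C = #H := by
  obtain ⟨hmax, hδ⟩ := h.isMaximalTrio hH
  obtain ⟨hAeq, hBst, -, -⟩ := h
  have hB : B.Nonempty := Nonempty.of_addStab (by rw [hBst]; exact hH.nonempty)
  have hA : A.Nonempty := by rw [hAeq]; exact hH.nonempty
  rw [hmax.trioDeficiency_eq_card_addStab' hA hB hδ, hAeq, hH.addStab_eq]

/-- The data of a pure chord in normal position: lengths below the period, exact cardinalities,
`A + B` a proper `R`-sequence. [cite: BoothbyDevosMontejano2013, §4] -/
theorem IsPureChordAt.card_eq (hH : IsSubgroupCarrier H) (h : IsPureChordAt H r A B C) :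
    ∃ a b : G, ∃ m n : ℕ, 2 ≤ m ∧ 2 ≤ n ∧ A = rseq H r a m ∧ B = rseq H r b n ∧
      A + B = rseq H r (a + b) (m + n - 1) ∧ A + B ≠ univ ∧
      #A = m * #H ∧ #B = n * #H ∧ #(A + B) = (m + n - 1) * #H := by
  obtain ⟨hgen, ⟨a, m, hm, rfl⟩, ⟨b, n, hn, rfl⟩, hCeq, hCcos⟩ := h
  obtain ⟨t, ht, htH, hmin⟩ := exists_minimal_nsmul_mem hH r
  have hC : C.Nonempty := by
    rw [nonempty_iff_ne_empty]; intro hCe; exact hCcos 0 (by rw [hCe]; exact empty_subset _)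
  have hsum := rseq_add_rseq hH r a b (by omega : 1 ≤ m) (by omega : 1 ≤ n)
  have hABne : rseq H r a m + rseq H r b n ≠ univ := by
    intro hu
    have : C = ∅ := by
      rw [hCeq, third, hu, Finset.neg_univ]; exact compl_univ
    exact hC.ne_empty this
  have hlt : m + n - 1 < t := lt_of_rseq_ne_univ hH hgen ht htH (hsum ▸ hABne)
  refine ⟨a, b, m, n, hm, hn, rfl, rfl, hsum, hABne, card_rseq hH hmin a (by omega),
    card_rseq hH hmin b (by omega), ?_⟩
  rw [hsum]; exact card_rseq hH hmin (a + b) hlt.le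

/-- **"Every pure chord relative to `H` is a maximal critical trio"** (remark after Definition 4.2):
two nontrivial `R`-sequences `A`, `B` with `third A B` outside a single coset form a pure critical
pair (`stab A = stab B = stab(A + B) = H` by `addStab_rseq`, `|A + B| = |A| + |B| − |H|`), so
Proposition 3.4 applies. [cite: BoothbyDevosMontejano2013, §4] -/
theorem IsPureChordAt.isMaximalTrio (hH : IsSubgroupCarrier H) (h : IsPureChordAt H r A B C) :
    IsMaximalTrio A B C ∧ 0 < trioDeficiency A B C := by
  have hgen := h.1
  have hCeq := h.2.2.2.1
  obtain ⟨a, b, m, n, hm, hn, hA, hB, hsum, hABne, hAc, hBc, hABc⟩ := h.card_eq hH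
  have hHpos := hH.nonempty.card_pos
  have hAne : A.Nonempty := by rw [hA]; exact rseq_nonempty hH r a (by omega)
  have hBne : B.Nonempty := by rw [hB]; exact rseq_nonempty hH r b (by omega)
  have hcrit : #(A + B) < #A + #B := by
    rw [hABc, hAc, hBc]
    have : (m + n - 1) * #H + #H = m * #H + n * #H := by
      rw [← Nat.succ_mul, show (m + n - 1).succ = m + n by omega, add_mul]
    omega
  have hAu : A ≠ univ := by
    intro hu
    have h1 : #A < #(A + B) := by
      rw [hAc, hABc]; exact (Nat.mul_lt_mul_right hHpos).2 (by omega)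
    rw [hu] at h1
    exact absurd h1 (not_lt.2 (card_le_univ _))
  have hBu : B ≠ univ := by
    intro hu
    have h1 : #B < #(A + B) := by
      rw [hBc, hABc]; exact (Nat.mul_lt_mul_right hHpos).2 (by omega)
    rw [hu] at h1
    exact absurd h1 (not_lt.2 (card_le_univ _))
  have hstAB : (A + B).addStab = H := by
    rw [hsum] at hABne ⊢; exact addStab_rseq hH hgen (by omega) hABne
  have hP : IsPurePair A B := by
    refine ⟨?_, ?_⟩
    · rw [hstAB, hA]; rw [hA] at hAu; exact addStab_rseq hH hgen (by omega) hAu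
    · rw [hstAB, hB]; rw [hB] at hBu; exact addStab_rseq hH hgen (by omega) hBu
  exact (purePair_critical_iff_maximalTrio hAne hBne).1 ⟨hP, hcrit, hCeq⟩

/-- **"… with deficiency `|H|`"** (pure chord). [cite: BoothbyDevosMontejano2013, §4] -/
theorem IsPureChordAt.trioDeficiency_eq (hH : IsSubgroupCarrier H) (h : IsPureChordAt H r A B C) :
    trioDeficiency A B C = #H := by
  obtain ⟨hmax, hδ⟩ := h.isMaximalTrio hH
  have hgen := h.1
  obtain ⟨a, b, m, n, hm, hn, hA, hB, hsum, hABne, -, -, -⟩ := h.card_eq hH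
  have hAne : A.Nonempty := by rw [hA]; exact rseq_nonempty hH r a (by omega)
  have hBne : B.Nonempty := by rw [hB]; exact rseq_nonempty hH r b (by omega)
  rw [hmax.trioDeficiency_eq_card_addStab hAne hBne hδ, hsum]
  rw [hsum] at hABne
  rw [addStab_rseq hH hgen (by omega) hABne]

/-! ## Continuations of impure beats -/

/-- The continuation of an impure beat is a trio (a subtrio of `(A,B,C)`).
[cite: BoothbyDevosMontejano2013, Def 4.3] -/
theorem IsImpureBeatAt.continuation_isTrio (_h : IsImpureBeatAt H A B C) (ht : IsTrio A B C) :
    IsTrio A (B ∩ H) (C ∩ H) :=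
  ht.mono Subset.rfl inter_subset_left inter_subset_left

/-- … and lives in `H`. [cite: BoothbyDevosMontejano2013, Def 4.3] -/
theorem IsImpureBeatAt.continuation_subset (h : IsImpureBeatAt H A B C) :
    A ⊆ H ∧ B ∩ H ⊆ H ∧ C ∩ H ⊆ H :=
  ⟨h.1, inter_subset_right, inter_subset_right⟩

/-- … and is nontrivial when `A` is ("`(A',B',C')` is a nontrivial trio in `H`").
[cite: BoothbyDevosMontejano2013, §4] -/
theorem IsImpureBeatAt.continuation_nonempty (h : IsImpureBeatAt H A B C) (hA : A.Nonempty) :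
    A.Nonempty ∧ (B ∩ H).Nonempty ∧ (C ∩ H).Nonempty :=
  ⟨hA, h.2.2.2.2.1, h.2.2.2.2.2⟩

/-- In an impure beat in normal position, `(A + B) ∖ H = B ∖ H` (the part of `B` outside `H` is
`H`-stable and `∅ ≠ A ⊆ H`). [cite: BoothbyDevosMontejano2013, §4] -/
theorem IsImpureBeatAt.add_sdiff_eq (hH : IsSubgroupCarrier H) (h : IsImpureBeatAt H A B C)
    (hA : A.Nonempty) : (A + B) \ H = B \ H := by
  obtain ⟨hAH, -, hBst, -, -, -⟩ := h
  obtain ⟨a₀, ha₀⟩ := hA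
  ext x
  rw [mem_sdiff, mem_sdiff]
  constructor
  · rintro ⟨hx, hxH⟩
    obtain ⟨a, ha, b, hb, rfl⟩ := mem_add.1 hx
    have hbH : b ∉ H := fun hbH => hxH (hH.add_mem (hAH ha) hbH)
    have : b + a ∈ B \ H := by
      rw [← hBst]; exact add_mem_add (mem_sdiff.2 ⟨hb, hbH⟩) (hAH ha)
    rw [add_comm] at this
    exact mem_sdiff.1 this
  · rintro ⟨hxB, hxH⟩
    refine ⟨?_, hxH⟩
    have : x + -a₀ ∈ B \ H := by
      rw [← hBst]; exact add_mem_add (mem_sdiff.2 ⟨hxB, hxH⟩) (hH.neg_mem (hAH ha₀))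
    have hx : x = a₀ + (x + -a₀) := by abel
    rw [hx]
    exact add_mem_add ha₀ (mem_sdiff.1 this).1

/-- **"`δ(A',B',C') = δ(A,B,C)`" for the continuation of an impure beat** (remark after
Definition 4.4), the deficiency of `(A, B ∩ H, C ∩ H)` being computed in the group `H`:
`|A| + |B ∩ H| + |C ∩ H| − |H| = δ(A,B,C)`.  (Outside `H`, `B` and `third A B` have complementary
sizes: `|B ∖ H| + |C ∖ H| = |G| − |H|`.) [cite: BoothbyDevosMontejano2013, §4] -/
theorem IsImpureBeatAt.continuation_deficiency (hH : IsSubgroupCarrier H) (h : IsImpureBeatAt H A B C)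
    (hA : A.Nonempty) : (#A : ℤ) + #(B ∩ H) + #(C ∩ H) - #H = trioDeficiency A B C := by
  have hAB := h.add_sdiff_eq hH hA
  obtain ⟨-, -, -, hCH, -, -⟩ := h
  -- outside `H`: `univ ∖ H = (C ∖ H) ⊔ (−(A+B) ∖ H)` and `−(A+B) ∖ H = −(B ∖ H)`
  have hneg : (-(A + B)) \ H = -(B \ H) := by
    rw [← hAB]; ext x
    rw [mem_sdiff, mem_neg', mem_neg', mem_sdiff]
    constructor
    · rintro ⟨h1, h2⟩; exact ⟨h1, fun h3 => h2 (by simpa using hH.neg_mem h3)⟩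
    · rintro ⟨h1, h2⟩; exact ⟨h1, fun h3 => h2 (hH.neg_mem h3)⟩
  have hunion : univ \ H = (C \ H) ∪ ((-(A + B)) \ H) := by
    ext x
    rw [mem_sdiff, mem_union, hCH, mem_sdiff, mem_sdiff, mem_third, mem_neg']
    constructor
    · rintro ⟨-, hxH⟩
      by_cases hx : -x ∈ A + B
      · exact Or.inr ⟨hx, hxH⟩
      · exact Or.inl ⟨hx, hxH⟩
    · rintro (⟨-, hxH⟩ | ⟨-, hxH⟩) <;> exact ⟨mem_univ _, hxH⟩
  have hdisj : Disjoint (C \ H) ((-(A + B)) \ H) := by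
    rw [hCH]
    exact disjoint_left.2 fun x hx hx' => (mem_third.1 (mem_sdiff.1 hx).1) (mem_neg'.1 (mem_sdiff.1 hx').1)
  have hcard : #(C \ H) + #(B \ H) + #H = Fintype.card G := by
    have h1 : #(univ \ H) = #(C \ H) + #((-(A + B)) \ H) := by
      rw [hunion, card_union_of_disjoint hdisj]
    rw [hneg, card_neg] at h1
    have h2 : #(univ \ H) + #H = #(univ : Finset G) := card_sdiff_add_card_eq_card (subset_univ H)
    rw [card_univ] at h2
    omega
  have hB := card_sdiff_add_card_inter B H
  have hC := card_sdiff_add_card_inter C H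
  unfold trioDeficiency
  omega

/-! ## Continuations of impure chords (the elementary part) -/

/-- The continuation of an impure chord is a trio (a subtrio of `(A,B,C)`).
[cite: BoothbyDevosMontejano2013, Def 4.4] -/
theorem IsImpureChordAt.continuation_isTrio (_h : IsImpureChordAt H r A B C) (ht : IsTrio A B C) :
    IsTrio (A ∩ H) (B ∩ H) (C ∩ H) :=
  ht.mono inter_subset_left inter_subset_left inter_subset_left

/-- … lives in `H`. [cite: BoothbyDevosMontejano2013, Def 4.4] -/
theorem IsImpureChordAt.continuation_subset (_h : IsImpureChordAt H r A B C) :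
    A ∩ H ⊆ H ∧ B ∩ H ⊆ H ∧ C ∩ H ⊆ H :=
  ⟨inter_subset_right, inter_subset_right, inter_subset_right⟩

/-- … and is nontrivial. [cite: BoothbyDevosMontejano2013, Def 4.4] -/
theorem IsImpureChordAt.continuation_nonempty (h : IsImpureChordAt H r A B C) :
    (A ∩ H).Nonempty ∧ (B ∩ H).Nonempty ∧ (C ∩ H).Nonempty :=
  h.2.2.2.2.2

end Converse


/-! ## Continuations of impure chords: the deficiency identity -/

section ChordContinuation

variable [Fintype G] {H A B C : Finset G} {r : G} {m n t : ℕ}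

/-- Outside `H`, the third set and the sumset have complementary sizes:
`|third A B ∖ H| + |(A + B) ∖ H| + |H| = |G|` (`x ↦ −x` exchanges `(A + B) ∖ H` and
`−(A + B) ∖ H` since `−H = H`). [cite: BoothbyDevosMontejano2013, §4] -/
theorem card_third_sdiff_add (hH : IsSubgroupCarrier H) (A B : Finset G) :
    #(third A B \ H) + #((A + B) \ H) + #H = Fintype.card G := by
  have hneg : (-(A + B)) \ H = -((A + B) \ H) := by
    ext x
    rw [mem_sdiff, mem_neg', mem_neg', mem_sdiff]
    constructor
    · rintro ⟨h1, h2⟩; exact ⟨h1, fun h3 => h2 (by simpa using hH.neg_mem h3)⟩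
    · rintro ⟨h1, h2⟩; exact ⟨h1, fun h3 => h2 (hH.neg_mem h3)⟩
  have hunion : univ \ H = (third A B \ H) ∪ ((-(A + B)) \ H) := by
    ext x
    rw [mem_sdiff, mem_union, mem_sdiff, mem_sdiff, mem_third, mem_neg']
    constructor
    · rintro ⟨-, hxH⟩
      by_cases hx : -x ∈ A + B
      · exact Or.inr ⟨hx, hxH⟩
      · exact Or.inl ⟨hx, hxH⟩
    · rintro (⟨-, hxH⟩ | ⟨-, hxH⟩) <;> exact ⟨mem_univ _, hxH⟩
  have hdisj : Disjoint (third A B \ H) ((-(A + B)) \ H) :=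
    disjoint_left.2 fun x hx hx' => (mem_third.1 (mem_sdiff.1 hx).1) (mem_neg'.1 (mem_sdiff.1 hx').1)
  have h1 : #(univ \ H) = #(third A B \ H) + #((-(A + B)) \ H) := by
    rw [hunion, card_union_of_disjoint hdisj]
  rw [hneg, card_neg] at h1
  have h2 : #(univ \ H) + #H = #(univ : Finset G) := card_sdiff_add_card_eq_card (subset_univ H)
  rw [card_univ] at h2
  omega

omit [Fintype G] in
/-- A coset `j•r + H` with `0 < j < t` (below the period) misses `H`. [cite: BoothbyDevosMontejano2013, §4] -/
theorem not_mem_of_mem_coset (hH : IsSubgroupCarrier H) (hmin : ∀ s : ℕ, 0 < s → s < t → s • r ∉ H)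
    {j : ℕ} (hj0 : 0 < j) (hjt : j < t) {x : G} (hx : x ∈ (j • r) +ᵥ H) : x ∉ H := by
  intro hxH
  rw [hH.mem_coset_iff] at hx
  have := hH.sub_mem hxH hx
  rw [sub_sub_cancel] at this
  exact hmin j hj0 hjt this

omit [Fintype G] in
/-- In an impure chord, the cosets `j•r + H`, `1 ≤ j ≤ m − 1`, `j < t`, of the basic sequence
`H ∪ A = rseq H r 0 m` lie in `A`. [cite: BoothbyDevosMontejano2013, Def 4.4] -/
theorem coset_subset_of_union_eq_rseq (hH : IsSubgroupCarrier H)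
    (hmin : ∀ s : ℕ, 0 < s → s < t → s • r ∉ H) (hHA : H ∪ A = rseq H r 0 m) {j : ℕ} (hj0 : 0 < j)
    (hjm : j < m) (hjt : j < t) : (j • r) +ᵥ H ⊆ A := by
  intro x hx
  have hx' : x ∈ rseq H r 0 m := coset_subset_rseq H r 0 hjm (by rwa [zero_add])
  rw [← hHA, mem_union] at hx'
  rcases hx' with hxH | hxA
  · exact (not_mem_of_mem_coset hH hmin hj0 hjt hx hxH).elim
  · exact hxA

omit [Fintype G] in
/-- The part of `A` outside `H` in an impure chord, below the period: `A ∖ H = rseq H r r (m − 1)`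
(the cosets `r + H, …, (m−1)r + H`). [cite: BoothbyDevosMontejano2013, Def 4.4] -/
theorem sdiff_eq_rseq_of_union_eq_rseq (hH : IsSubgroupCarrier H)
    (hmin : ∀ s : ℕ, 0 < s → s < t → s • r ∉ H) (hHA : H ∪ A = rseq H r 0 m) (hm : 1 ≤ m)
    (hmt : m ≤ t) : A \ H = rseq H r r (m - 1) := by
  ext x
  rw [mem_sdiff, mem_rseq]
  constructor
  · rintro ⟨hxA, hxH⟩
    have hx : x ∈ rseq H r 0 m := by rw [← hHA]; exact mem_union_right _ hxA
    rw [mem_rseq] at hx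
    obtain ⟨i, hi, hx⟩ := hx
    rw [zero_add] at hx
    have hi0 : i ≠ 0 := by
      rintro rfl; rw [zero_nsmul] at hx
      exact hxH (by rw [hH.mem_coset_iff, sub_zero] at hx; exact hx)
    refine ⟨i - 1, by omega, ?_⟩
    have e : r + (i - 1) • r = i • r := by
      conv_rhs => rw [show i = (i - 1) + 1 by omega, add_nsmul, one_nsmul]
      abel
    rw [e]; exact hx
  · rintro ⟨i, hi, hx⟩
    have e : r + i • r = (i + 1) • r := by rw [add_nsmul, one_nsmul, add_comm]
    rw [e] at hx
    refine ⟨coset_subset_of_union_eq_rseq hH hmin hHA (by omega) (by omega) (by omega) hx,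
      not_mem_of_mem_coset hH hmin (by omega) (by omega) hx⟩

/-- In an impure chord (normal position) the lengths stay below the period:
`m + n − 2 < t` — otherwise the cosets `j•r + H`, `1 ≤ j < t`, all lie in `A + B`, so
`third A B ∖ H = ∅`, contradicting `C ∖ H ≠ ∅`. [cite: BoothbyDevosMontejano2013, Def 4.4] -/
theorem IsImpureChordAt.add_sub_two_lt (hH : IsSubgroupCarrier H) (h : IsImpureChordAt H r A B C)
    (hHA : H ∪ A = rseq H r 0 m) (hHB : H ∪ B = rseq H r 0 n) (hm : 2 ≤ m)
    (ht : 0 < t) (htH : t • r ∈ H) (hmin : ∀ s : ℕ, 0 < s → s < t → s • r ∉ H) :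
    m + n - 2 < t := by
  obtain ⟨hgen, -, -, hCH, hCne, hA0, hB0, -⟩ := h
  by_contra hle
  push Not at hle
  obtain ⟨a₀, ha₀⟩ := hA0
  obtain ⟨b₀, hb₀⟩ := hB0
  rw [mem_inter] at ha₀ hb₀
  -- every coset `j•r + H`, `1 ≤ j < t`, lies in `A + B`
  have hcos : ∀ j : ℕ, 0 < j → j < t → (j • r) +ᵥ H ⊆ A + B := by
    intro j hj0 hjt x hx
    by_cases hjm : j < m
    · -- coset ⊆ A, add `b₀ ∈ B ∩ H`
      have hy : x - b₀ ∈ (j • r) +ᵥ H := by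
        rw [hH.mem_coset_iff] at hx ⊢
        have e : x - b₀ - j • r = (x - j • r) - b₀ := by abel
        rw [e]; exact hH.sub_mem hx hb₀.2
      have := add_mem_add (coset_subset_of_union_eq_rseq hH hmin hHA hj0 hjm hjt hy) hb₀.1
      rwa [sub_add_cancel] at this
    by_cases hjn : j < n
    · have hy : x - a₀ ∈ (j • r) +ᵥ H := by
        rw [hH.mem_coset_iff] at hx ⊢
        have e : x - a₀ - j • r = (x - j • r) - a₀ := by abel
        rw [e]; exact hH.sub_mem hx ha₀.2
      have := add_mem_add ha₀.1 (coset_subset_of_union_eq_rseq hH hmin hHB hj0 hjn hjt hy)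
      rwa [add_sub_cancel] at this
    · -- `j = (m − 1) + (j − m + 1)` with both parts in range
      push Not at hjm hjn
      set k := j + 1 - m with hk
      have hk0 : 0 < k := by omega
      have hkn : k < n := by omega
      have hkt : k < t := by omega
      have hm1t : m - 1 < t := by omega
      have hy : k • r ∈ B :=
        coset_subset_of_union_eq_rseq hH hmin hHB hk0 hkn hkt (hH.mem_coset_self _)
      have hz : x - k • r ∈ ((m - 1) • r) +ᵥ H := by
        rw [hH.mem_coset_iff] at hx ⊢
        have e : x - k • r - (m - 1) • r = x - j • r := by
          rw [sub_sub, ← add_nsmul, show k + (m - 1) = j by omega]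
        rw [e]; exact hx
      have := add_mem_add (coset_subset_of_union_eq_rseq hH hmin hHA (by omega) (by omega) hm1t hz) hy
      rwa [sub_add_cancel] at this
  -- hence `univ ∖ H ⊆ A + B`
  have hout : ∀ x : G, x ∉ H → x ∈ A + B := by
    intro x hxH
    obtain ⟨i, hi⟩ := hgen x
    set j := i % t with hj
    have hxj : x ∈ (j • r) +ᵥ H := by
      rw [hH.mem_coset_iff] at hi ⊢
      have hi' : i • r = j • r + (t * (i / t)) • r := by rw [hj, ← add_nsmul, Nat.mod_add_div]
      have e : x - j • r = (x - i • r) + (t * (i / t)) • r := by rw [hi']; abel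
      rw [e]; exact hH.add_mem hi (hH.mul_nsmul_mem htH _)
    have hj0 : 0 < j := by
      rcases Nat.eq_zero_or_pos j with h0 | h0
      · rw [h0, zero_nsmul] at hxj
        exact (hxH (by rw [hH.mem_coset_iff, sub_zero] at hxj; exact hxj)).elim
      · exact h0
    exact hcos j hj0 (Nat.mod_lt i ht) hxj
  -- so `C ∖ H = third A B ∖ H = ∅`
  obtain ⟨c, hc⟩ := hCne
  rw [hCH, mem_sdiff, mem_third] at hc
  exact hc.1 (hout (-c) fun h => hc.2 (by simpa using hH.neg_mem h))

/-- In an impure chord below the period, `(A + B) ∖ H = rseq H r r (m + n − 2)` (the cosets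
`r + H, …, (m + n − 2)r + H`). [cite: BoothbyDevosMontejano2013, Def 4.4] -/
theorem IsImpureChordAt.add_sdiff_eq (hH : IsSubgroupCarrier H) (h : IsImpureChordAt H r A B C)
    (hHA : H ∪ A = rseq H r 0 m) (hHB : H ∪ B = rseq H r 0 n) (hm : 2 ≤ m) (hn : 2 ≤ n)
    (hmin : ∀ s : ℕ, 0 < s → s < t → s • r ∉ H) (hlt : m + n - 2 < t) :
    (A + B) \ H = rseq H r r (m + n - 2) := by
  obtain ⟨-, -, -, -, -, hA0, hB0, -⟩ := h
  obtain ⟨b₀, hb₀⟩ := hB0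
  rw [mem_inter] at hb₀
  have hAH : A \ H = rseq H r r (m - 1) :=
    sdiff_eq_rseq_of_union_eq_rseq hH hmin hHA (by omega) (by omega)
  have hBH : B \ H = rseq H r r (n - 1) :=
    sdiff_eq_rseq_of_union_eq_rseq hH hmin hHB (by omega) (by omega)
  ext x
  rw [mem_sdiff]
  constructor
  · rintro ⟨hx, hxH⟩
    obtain ⟨a, ha, b, hb, rfl⟩ := mem_add.1 hx
    by_cases haH : a ∈ H
    · by_cases hbH : b ∈ H
      · exact (hxH (hH.add_mem haH hbH)).elim
      · have hb' : b ∈ rseq H r r (n - 1) := by rw [← hBH]; exact mem_sdiff.2 ⟨hb, hbH⟩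
        rw [mem_rseq] at hb' ⊢
        obtain ⟨i, hi, hb'⟩ := hb'
        refine ⟨i, by omega, ?_⟩
        rw [hH.mem_coset_iff] at hb' ⊢
        have e : a + b - (r + i • r) = a + (b - (r + i • r)) := by abel
        rw [e]; exact hH.add_mem haH hb'
    · have ha' : a ∈ rseq H r r (m - 1) := by rw [← hAH]; exact mem_sdiff.2 ⟨ha, haH⟩
      rw [mem_rseq] at ha'
      obtain ⟨i, hi, ha'⟩ := ha'
      by_cases hbH : b ∈ H
      · rw [mem_rseq]
        refine ⟨i, by omega, ?_⟩
        rw [hH.mem_coset_iff] at ha' ⊢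
        have e : a + b - (r + i • r) = (a - (r + i • r)) + b := by abel
        rw [e]; exact hH.add_mem ha' hbH
      · have hb' : b ∈ rseq H r r (n - 1) := by rw [← hBH]; exact mem_sdiff.2 ⟨hb, hbH⟩
        rw [mem_rseq] at hb'
        obtain ⟨j, hj, hb'⟩ := hb'
        rw [mem_rseq]
        refine ⟨i + j + 1, by omega, ?_⟩
        rw [hH.mem_coset_iff] at ha' hb' ⊢
        have e : a + b - (r + (i + j + 1) • r) = (a - (r + i • r)) + (b - (r + j • r)) := by
          rw [add_nsmul, add_nsmul, one_nsmul]; abel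
        rw [e]; exact hH.add_mem ha' hb'
  · intro hx
    rw [mem_rseq] at hx
    obtain ⟨k, hk, hxk⟩ := hx
    have e : r + k • r = (k + 1) • r := by rw [add_nsmul, one_nsmul, add_comm]
    rw [e] at hxk
    refine ⟨?_, not_mem_of_mem_coset hH hmin (by omega) (by omega) hxk⟩
    by_cases hkm : k + 1 < m
    · have hy : x - b₀ ∈ ((k + 1) • r) +ᵥ H := by
        rw [hH.mem_coset_iff] at hxk ⊢
        have e : x - b₀ - (k + 1) • r = (x - (k + 1) • r) - b₀ := by abel
        rw [e]; exact hH.sub_mem hxk hb₀.2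
      have := add_mem_add (coset_subset_of_union_eq_rseq hH hmin hHA (by omega) hkm (by omega) hy)
        hb₀.1
      rwa [sub_add_cancel] at this
    · push Not at hkm
      set l := k + 2 - m with hl
      have hl0 : 0 < l := by omega
      have hln : l < n := by omega
      have hy : l • r ∈ B :=
        coset_subset_of_union_eq_rseq hH hmin hHB hl0 hln (by omega) (hH.mem_coset_self _)
      have hz : x - l • r ∈ ((m - 1) • r) +ᵥ H := by
        rw [hH.mem_coset_iff] at hxk ⊢
        have e : x - l • r - (m - 1) • r = x - (k + 1) • r := by
          rw [sub_sub, ← add_nsmul, show l + (m - 1) = k + 1 by omega]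
        rw [e]; exact hxk
      have := add_mem_add
        (coset_subset_of_union_eq_rseq hH hmin hHA (by omega) (by omega) (by omega) hz) hy
      rwa [sub_add_cancel] at this

/-- **"`δ(A',B',C') = δ(A,B,C)`" for the continuation of an impure chord** (remark after
Definition 4.4), the deficiency of `(A ∩ H, B ∩ H, C ∩ H)` being computed in `H`:
`|A ∩ H| + |B ∩ H| + |C ∩ H| − |H| = δ(A,B,C)`.  Bookkeeping: with `t` the period,
`m + n − 2 < t` (`IsImpureChordAt.add_sub_two_lt`), `|A ∖ H| = (m−1)|H|`, `|B ∖ H| = (n−1)|H|`,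
`|(A + B) ∖ H| = (m+n−2)|H|`, and `|third A B ∖ H| + |(A + B) ∖ H| + |H| = |G|`.
[cite: BoothbyDevosMontejano2013, §4] -/
theorem IsImpureChordAt.continuation_deficiency (hH : IsSubgroupCarrier H)
    (h : IsImpureChordAt H r A B C) :
    (#(A ∩ H) : ℤ) + #(B ∩ H) + #(C ∩ H) - #H = trioDeficiency A B C := by
  obtain ⟨t, ht, htH, hmin⟩ := exists_minimal_nsmul_mem hH r
  obtain ⟨hgen, ⟨m, hm, hHA⟩, ⟨n, hn, hHB⟩, hCH, hCne, hA0, hB0, hC0⟩ := id h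
  have hlt : m + n - 2 < t := h.add_sub_two_lt hH hHA hHB hm ht htH hmin
  have hAH : #(A \ H) = (m - 1) * #H := by
    rw [sdiff_eq_rseq_of_union_eq_rseq hH hmin hHA (by omega) (by omega)]
    exact card_rseq hH hmin r (by omega)
  have hBH : #(B \ H) = (n - 1) * #H := by
    rw [sdiff_eq_rseq_of_union_eq_rseq hH hmin hHB (by omega) (by omega)]
    exact card_rseq hH hmin r (by omega)
  have hABH : #((A + B) \ H) = (m + n - 2) * #H := by
    rw [h.add_sdiff_eq hH hHA hHB hm hn hmin hlt]
    exact card_rseq hH hmin r hlt.le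
  have hCH' : #(C \ H) = #(third A B \ H) := by rw [hCH]
  have htot := card_third_sdiff_add hH A B
  have hA := card_sdiff_add_card_inter A H
  have hB := card_sdiff_add_card_inter B H
  have hC := card_sdiff_add_card_inter C H
  have e : (m + n - 2) * #H = (m - 1) * #H + (n - 1) * #H := by
    rw [← add_mul]; congr 1; omega
  unfold trioDeficiency
  omega

end ChordContinuation

/-! ## Relative maximality: continuations of maximal trios are maximal in `H` -/

section RelativeMaximality

variable {K H A B C : Finset G} {r : G}

/-- The DEFICIENCY of a triple computed IN an ambient finite set `K`:
`δ_K(A,B,C) = |A| + |B| + |C| − |K|` (Definition 3.2 for the group `K`, e.g. a subgroup `H < G`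
carrying a continuation; for `K = univ` this is `trioDeficiency`).
[cite: BoothbyDevosMontejano2013, Def 3.2; §4] -/
def trioDeficiencyIn (K A B C : Finset G) : ℤ := (#A : ℤ) + #B + #C - #K

/-- A triple is a MAXIMAL TRIO IN `K`: its members lie in `K`, it is a trio, and it has no proper
supertrio with members in `K` (maximality of §3 for the ambient group `K`; for `K = univ` this is
`IsMaximalTrio`, see `isMaximalTrioIn_univ_iff`). [cite: BoothbyDevosMontejano2013, §3; §4] -/
def IsMaximalTrioIn (K A B C : Finset G) : Prop :=
  A ⊆ K ∧ B ⊆ K ∧ C ⊆ K ∧ IsTrio A B C ∧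
    ∀ ⦃A' B' C' : Finset G⦄, A ⊆ A' → B ⊆ B' → C ⊆ C' → A' ⊆ K → B' ⊆ K → C' ⊆ K →
      IsTrio A' B' C' → A' = A ∧ B' = B ∧ C' = C

omit [AddCommGroup G] [DecidableEq G] in
/-- Unfolding lemma. [cite: BoothbyDevosMontejano2013, Def 3.2] -/
theorem trioDeficiencyIn_def (K A B C : Finset G) :
    trioDeficiencyIn K A B C = (#A : ℤ) + #B + #C - #K := rfl

/-- Unfolding lemma. [cite: BoothbyDevosMontejano2013, §3] -/
theorem isMaximalTrioIn_def : IsMaximalTrioIn K A B C ↔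
    A ⊆ K ∧ B ⊆ K ∧ C ⊆ K ∧ IsTrio A B C ∧
      ∀ ⦃A' B' C' : Finset G⦄, A ⊆ A' → B ⊆ B' → C ⊆ C' → A' ⊆ K → B' ⊆ K → C' ⊆ K →
        IsTrio A' B' C' → A' = A ∧ B' = B ∧ C' = C := Iff.rfl

/-- A maximal trio in `K` is a trio. [cite: BoothbyDevosMontejano2013, §3] -/
theorem IsMaximalTrioIn.isTrio (h : IsMaximalTrioIn K A B C) : IsTrio A B C := h.2.2.2.1

/-- … with members in `K`. [cite: BoothbyDevosMontejano2013, §3] -/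
theorem IsMaximalTrioIn.subset (h : IsMaximalTrioIn K A B C) : A ⊆ K ∧ B ⊆ K ∧ C ⊆ K :=
  ⟨h.1, h.2.1, h.2.2.1⟩

variable [Fintype G]

omit [AddCommGroup G] [DecidableEq G] in
/-- For `K = univ` the relative deficiency is the deficiency. [cite: BoothbyDevosMontejano2013, Def 3.2] -/
theorem trioDeficiencyIn_univ (A B C : Finset G) :
    trioDeficiencyIn univ A B C = trioDeficiency A B C := by
  rw [trioDeficiencyIn, trioDeficiency, card_univ]

/-- Maximality in `K` in terms of third sets: `(A,B,C)` with members in `K` is maximal in `K` iff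
`C = K ∩ third A B`, `B = K ∩ third A C` and `A = K ∩ third B C` (the relative form of
"`(A,B,C)` is maximal iff `C = \overline{−(A+B)}`, …"). [cite: BoothbyDevosMontejano2013, §3] -/
theorem isMaximalTrioIn_iff : IsMaximalTrioIn K A B C ↔
    A ⊆ K ∧ B ⊆ K ∧ C ⊆ K ∧ C = K ∩ third A B ∧ B = K ∩ third A C ∧ A = K ∩ third B C := by
  constructor
  · rintro ⟨hA, hB, hC, ht, hmax⟩
    refine ⟨hA, hB, hC, ?_, ?_, ?_⟩
    · have hsub : C ⊆ K ∩ third A B := subset_inter hC (isTrio_iff_subset_third.1 ht)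
      have htrio : IsTrio A B (K ∩ third A B) :=
        (isTrio_third A B).mono Subset.rfl Subset.rfl inter_subset_right
      exact ((hmax Subset.rfl Subset.rfl hsub hA hB inter_subset_left htrio).2.2).symm
    · have hsub : B ⊆ K ∩ third A C := subset_inter hB (isTrio_iff_subset_third.1 ht.swap_right)
      have htrio : IsTrio A (K ∩ third A C) C :=
        ((isTrio_third A C).mono Subset.rfl Subset.rfl inter_subset_right).swap_right
      exact ((hmax Subset.rfl hsub Subset.rfl hA inter_subset_left hC htrio).2.1).symm
    · have hsub : A ⊆ K ∩ third B C := subset_inter hA (isTrio_iff_subset_third.1 ht.rotate)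
      have htrio : IsTrio (K ∩ third B C) B C :=
        ((isTrio_third B C).mono Subset.rfl Subset.rfl inter_subset_right).rotate.rotate
      exact ((hmax hsub Subset.rfl Subset.rfl inter_subset_left hB hC htrio).1).symm
  · rintro ⟨hA, hB, hC, eC, eB, eA⟩
    refine ⟨hA, hB, hC, isTrio_iff_subset_third.2 (eC.trans_subset inter_subset_right),
      fun A' B' C' hA' hB' hC' hA'K hB'K hC'K h' => ?_⟩
    have eC' : C' = C := Subset.antisymm
      ((subset_inter hC'K (isTrio_iff_subset_third.1 h')).trans
        ((inter_subset_inter_left (third_mono hA' hB')).trans (subset_of_eq eC.symm))) hC'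
    have eB' : B' = B := Subset.antisymm
      ((subset_inter hB'K (isTrio_iff_subset_third.1 h'.swap_right)).trans
        ((inter_subset_inter_left (third_mono hA' hC')).trans (subset_of_eq eB.symm))) hB'
    have eA' : A' = A := Subset.antisymm
      ((subset_inter hA'K (isTrio_iff_subset_third.1 h'.rotate)).trans
        ((inter_subset_inter_left (third_mono hB' hC')).trans (subset_of_eq eA.symm))) hA'
    exact ⟨eA', eB', eC'⟩

/-- For `K = univ`, maximality in `K` is maximality (§3). [cite: BoothbyDevosMontejano2013, §3] -/
theorem isMaximalTrioIn_univ_iff : IsMaximalTrioIn univ A B C ↔ IsMaximalTrio A B C := by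
  rw [isMaximalTrioIn_iff, isMaximalTrio_iff]
  simp only [subset_univ, univ_inter, true_and]

omit [DecidableEq G] in
/-- If a whole coset `p + H` lies in `P` and `p + q ∈ H` for some `q ∈ Q`, then `H ⊆ −(P + Q)`:
`H` misses `third P Q`. [cite: BoothbyDevosMontejano2013, §4] -/
theorem inter_third_eq_empty_of_coset_subset [DecidableEq G] (hH : IsSubgroupCarrier H)
    {P Q : Finset G} {p q : G} (hp : p +ᵥ H ⊆ P) (hq : q ∈ Q) (hpq : p + q ∈ H) :
    H ∩ third P Q = ∅ := by
  rw [← not_nonempty_iff_eq_empty]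
  rintro ⟨y, hy⟩
  rw [mem_inter, mem_third] at hy
  refine hy.2 (mem_add.2 ⟨p + -(y + (p + q)), hp ?_, q, hq, by abel⟩)
  rw [hH.mem_coset_iff]
  have e : p + -(y + (p + q)) - p = -(y + (p + q)) := by abel
  rw [e]
  exact hH.neg_mem (hH.add_mem hy.1 hpq)

/-- ENGINE of the remark "continuations of maximal trios are maximal": if `R = third P Q`, `R`
meets `H`, and every point of `P` outside `H` carries its whole `H`-coset inside `P`, then
`R ∩ H = H ∩ third (P ∩ H) (Q ∩ H)` — a representation `−x = p + q` of `−x ∈ H` either has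
`p, q ∈ H` or exhibits `H ⊆ −(P + Q)`, i.e. `R ∩ H = ∅`. [cite: BoothbyDevosMontejano2013, §4] -/
theorem inter_eq_inter_third_inter (hH : IsSubgroupCarrier H) {P Q R : Finset G}
    (hR : R = third P Q) (hRH : (R ∩ H).Nonempty) (hP : ∀ p ∈ P, p ∉ H → p +ᵥ H ⊆ P) :
    R ∩ H = H ∩ third (P ∩ H) (Q ∩ H) := by
  subst hR
  ext x
  simp only [mem_inter, mem_third]
  constructor
  · rintro ⟨hx, hxH⟩
    exact ⟨hxH, fun h => hx (add_subset_add inter_subset_left inter_subset_left h)⟩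
  · rintro ⟨hxH, hx⟩
    refine ⟨fun h => ?_, hxH⟩
    obtain ⟨p, hp, q, hq, hpq⟩ := mem_add.1 h
    by_cases hpH : p ∈ H
    · have hqH : q ∈ H := by
        have e : q = -x - p := by rw [← hpq]; abel
        rw [e]; exact hH.sub_mem (hH.neg_mem hxH) hpH
      exact hx (mem_add.2 ⟨p, mem_inter.2 ⟨hp, hpH⟩, q, mem_inter.2 ⟨hq, hqH⟩, hpq⟩)
    · have hempty := inter_third_eq_empty_of_coset_subset hH (hP p hp hpH) hq
        (by rw [hpq]; exact hH.neg_mem hxH)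
      rw [inter_comm] at hempty
      exact hRH.ne_empty hempty

/-- In an impure beat (normal position) every point of `B` outside `H` carries its `H`-coset inside
`B` ("`B ∖ H` is `H`-stable"). [cite: BoothbyDevosMontejano2013, Def 4.3] -/
theorem IsImpureBeatAt.coset_subset (hH : IsSubgroupCarrier H) (h : IsImpureBeatAt H A B C) {b : G}
    (hb : b ∈ B) (hbH : b ∉ H) : b +ᵥ H ⊆ B :=
  (hH.coset_subset_of_stable h.2.2.1 (mem_sdiff.2 ⟨hb, hbH⟩)).trans sdiff_subset

/-- "`(A', B', C')` will be maximal whenever `(A,B,C)` is maximal" — IMPURE BEATS: the continuation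
`(A, B ∩ H, C ∩ H)` of a MAXIMAL impure beat in normal position (with `A ≠ ∅`) is a maximal trio
in `H`. [cite: BoothbyDevosMontejano2013, §4] -/
theorem IsImpureBeatAt.continuation_isMaximalTrioIn (hH : IsSubgroupCarrier H)
    (h : IsImpureBeatAt H A B C) (hmax : IsMaximalTrio A B C) (hA : A.Nonempty) :
    IsMaximalTrioIn H A (B ∩ H) (C ∩ H) := by
  have hPb : ∀ p ∈ B, p ∉ H → p +ᵥ H ⊆ B := fun p hp hpH => h.coset_subset hH hp hpH
  obtain ⟨hAH, -, -, -, hBH, hCH⟩ := h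
  have hPa : ∀ p ∈ A, p ∉ H → p +ᵥ H ⊆ A := fun p hp hpH => (hpH (hAH hp)).elim
  have hAi : A ∩ H = A := inter_eq_left.2 hAH
  obtain ⟨eC, eB, eA⟩ := isMaximalTrio_iff.1 hmax
  rw [isMaximalTrioIn_iff]
  refine ⟨hAH, inter_subset_right, inter_subset_right, ?_, ?_, ?_⟩
  · have := inter_eq_inter_third_inter hH eC hCH hPa
    rwa [hAi] at this
  · have := inter_eq_inter_third_inter hH eB hBH hPa
    rwa [hAi] at this
  · have := inter_eq_inter_third_inter hH eA (by rwa [hAi]) hPb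
    rwa [hAi] at this

/-- The impure-chord predicate is symmetric in `A`, `B`. [cite: BoothbyDevosMontejano2013, Def 4.4] -/
theorem IsImpureChordAt.swap (h : IsImpureChordAt H r A B C) : IsImpureChordAt H r B A C := by
  obtain ⟨hgen, hA, hB, hCH, hCne, hA0, hB0, hC0⟩ := h
  exact ⟨hgen, hB, hA, by rwa [third_comm] at hCH, hCne, hB0, hA0, hC0⟩

/-- In an impure chord (normal position) every point of `A` outside `H` carries its `H`-coset inside
`A` (it lies in one of the cosets `j•r + H`, `1 ≤ j ≤ m − 1 < t`, of the basic sequence `H ∪ A`).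
[cite: BoothbyDevosMontejano2013, Def 4.4] -/
theorem IsImpureChordAt.coset_subset (hH : IsSubgroupCarrier H) (h : IsImpureChordAt H r A B C)
    {a : G} (ha : a ∈ A) (haH : a ∉ H) : a +ᵥ H ⊆ A := by
  obtain ⟨t, ht, htH, hmin⟩ := exists_minimal_nsmul_mem hH r
  obtain ⟨-, ⟨m, hm, hHA⟩, ⟨n, hn, hHB⟩, -, -, -, -, -⟩ := id h
  have hlt : m + n - 2 < t := h.add_sub_two_lt hH hHA hHB hm ht htH hmin
  have hmt : m ≤ t := by omega
  have ha' : a ∈ rseq H r 0 m := by rw [← hHA]; exact mem_union_right _ ha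
  rw [mem_rseq] at ha'
  obtain ⟨j, hjm, hj⟩ := ha'
  rw [zero_add] at hj
  have hj0 : 0 < j := by
    rcases Nat.eq_zero_or_pos j with rfl | hpos
    · rw [zero_nsmul] at hj
      exact (haH (by rw [hH.mem_coset_iff, sub_zero] at hj; exact hj)).elim
    · exact hpos
  rw [hH.coset_eq_of_mem hj]
  exact coset_subset_of_union_eq_rseq hH hmin hHA hj0 hjm (lt_of_lt_of_le hjm hmt)

/-- "`(A', B', C')` will be maximal whenever `(A,B,C)` is maximal" — IMPURE CHORDS: the
continuation `(A ∩ H, B ∩ H, C ∩ H)` of a MAXIMAL impure chord in normal position is a maximal trio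
in `H`. [cite: BoothbyDevosMontejano2013, §4] -/
theorem IsImpureChordAt.continuation_isMaximalTrioIn (hH : IsSubgroupCarrier H)
    (h : IsImpureChordAt H r A B C) (hmax : IsMaximalTrio A B C) :
    IsMaximalTrioIn H (A ∩ H) (B ∩ H) (C ∩ H) := by
  have hPa : ∀ p ∈ A, p ∉ H → p +ᵥ H ⊆ A := fun p hp hpH => h.coset_subset hH hp hpH
  have hPb : ∀ p ∈ B, p ∉ H → p +ᵥ H ⊆ B := fun p hp hpH => h.swap.coset_subset hH hp hpH
  obtain ⟨-, -, -, -, -, hA0, hB0, hC0⟩ := h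
  obtain ⟨eC, eB, eA⟩ := isMaximalTrio_iff.1 hmax
  rw [isMaximalTrioIn_iff]
  exact ⟨inter_subset_right, inter_subset_right, inter_subset_right,
    inter_eq_inter_third_inter hH eC hC0 hPa, inter_eq_inter_third_inter hH eB hB0 hPa,
    inter_eq_inter_third_inter hH eA hA0 hPb⟩

/-- The deficiency identity of an impure-beat continuation, in relative notation:
`δ_H(A, B ∩ H, C ∩ H) = δ(A,B,C)`. [cite: BoothbyDevosMontejano2013, §4] -/
theorem IsImpureBeatAt.continuation_trioDeficiencyIn (hH : IsSubgroupCarrier H)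
    (h : IsImpureBeatAt H A B C) (hA : A.Nonempty) :
    trioDeficiencyIn H A (B ∩ H) (C ∩ H) = trioDeficiency A B C :=
  h.continuation_deficiency hH hA

/-- The deficiency identity of an impure-chord continuation, in relative notation:
`δ_H(A ∩ H, B ∩ H, C ∩ H) = δ(A,B,C)`. [cite: BoothbyDevosMontejano2013, §4] -/
theorem IsImpureChordAt.continuation_trioDeficiencyIn (hH : IsSubgroupCarrier H)
    (h : IsImpureChordAt H r A B C) :
    trioDeficiencyIn H (A ∩ H) (B ∩ H) (C ∩ H) = trioDeficiency A B C :=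
  h.continuation_deficiency hH

/-- THE WHOLE REMARK for impure beats: "if `(A,B,C)` is an impure beat … and `(A',B',C')` is a
continuation, then … `(A',B',C')` is a nontrivial trio in `H`.  Furthermore … `(A',B',C')` will be
maximal whenever `(A,B,C)` is maximal, and `δ(A',B',C') = δ(A,B,C)`" — for a maximal impure beat in
normal position with `A ≠ ∅`. [cite: BoothbyDevosMontejano2013, §4] -/
theorem IsImpureBeatAt.continuation (hH : IsSubgroupCarrier H) (h : IsImpureBeatAt H A B C)
    (hmax : IsMaximalTrio A B C) (hA : A.Nonempty) :
    IsMaximalTrioIn H A (B ∩ H) (C ∩ H) ∧ A.Nonempty ∧ (B ∩ H).Nonempty ∧ (C ∩ H).Nonempty ∧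
      trioDeficiencyIn H A (B ∩ H) (C ∩ H) = trioDeficiency A B C :=
  ⟨h.continuation_isMaximalTrioIn hH hmax hA, hA, h.2.2.2.2.1, h.2.2.2.2.2,
    h.continuation_trioDeficiencyIn hH hA⟩

/-- THE WHOLE REMARK for impure chords: the continuation `(A ∩ H, B ∩ H, C ∩ H)` of a maximal
impure chord in normal position is a nontrivial maximal trio in `H` with the same deficiency.
[cite: BoothbyDevosMontejano2013, §4] -/
theorem IsImpureChordAt.continuation (hH : IsSubgroupCarrier H) (h : IsImpureChordAt H r A B C)
    (hmax : IsMaximalTrio A B C) :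
    IsMaximalTrioIn H (A ∩ H) (B ∩ H) (C ∩ H) ∧ (A ∩ H).Nonempty ∧ (B ∩ H).Nonempty ∧
      (C ∩ H).Nonempty ∧ trioDeficiencyIn H (A ∩ H) (B ∩ H) (C ∩ H) = trioDeficiency A B C :=
  ⟨h.continuation_isMaximalTrioIn hH hmax, h.2.2.2.2.2.1, h.2.2.2.2.2.2.1, h.2.2.2.2.2.2.2,
    h.continuation_trioDeficiencyIn hH⟩

end RelativeMaximality

/-! ## The converse half and the continuation remark, up to similarity -/

section UpToSimilarity

variable [Fintype G] {H A B C : Finset G}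

/-- "Every pure beat relative to `H` is a maximal critical trio with deficiency `|H|`" — for the
similarity-closed notion `IsPureBeat` (Definition 4.1 as printed). [cite: BoothbyDevosMontejano2013, §4] -/
theorem IsPureBeat.isMaximalTrio (hH : IsSubgroupCarrier H) (h : IsPureBeat H (A, B, C)) :
    IsMaximalTrio A B C ∧ 0 < trioDeficiency A B C ∧ trioDeficiency A B C = #H := by
  obtain ⟨A₀, B₀, C₀, h₀, hsim⟩ := h
  obtain ⟨hmax, hδ⟩ := h₀.isMaximalTrio hH
  have hδeq := h₀.trioDeficiency_eq hH
  rw [hsim.trioDeficiency_eq] at hδ hδeq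
  exact ⟨hsim.isMaximalTrio_iff.1 hmax, hδ, hδeq⟩

/-- "Every pure chord relative to `H` is a maximal critical trio with deficiency `|H|`" — for the
similarity-closed notion `IsPureChord` (Definition 4.2 as printed). [cite: BoothbyDevosMontejano2013, §4] -/
theorem IsPureChord.isMaximalTrio (hH : IsSubgroupCarrier H) (h : IsPureChord H (A, B, C)) :
    IsMaximalTrio A B C ∧ 0 < trioDeficiency A B C ∧ trioDeficiency A B C = #H := by
  obtain ⟨r, A₀, B₀, C₀, h₀, hsim⟩ := h
  obtain ⟨hmax, hδ⟩ := h₀.isMaximalTrio hH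
  have hδeq := h₀.trioDeficiency_eq hH
  rw [hsim.trioDeficiency_eq] at hδ hδeq
  exact ⟨hsim.isMaximalTrio_iff.1 hmax, hδ, hδeq⟩

/-- The continuation remark for the similarity-closed notion `IsImpureBeat` (Definition 4.3 as
printed): a maximal nontrivial impure beat `Υ` relative to `H` is similar to a trio `(A₀,B₀,C₀)` in
normal position whose continuation `(A₀, B₀ ∩ H, C₀ ∩ H)` is a nontrivial maximal trio in `H` with
`δ_H = δ(Υ)`. [cite: BoothbyDevosMontejano2013, §4] -/
theorem IsImpureBeat.exists_continuation (hH : IsSubgroupCarrier H) (h : IsImpureBeat H (A, B, C))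
    (hmax : IsMaximalTrio A B C) (hA : A.Nonempty) (hB : B.Nonempty) (hC : C.Nonempty) :
    ∃ A₀ B₀ C₀ : Finset G, Similar (A₀, B₀, C₀) (A, B, C) ∧ IsImpureBeatAt H A₀ B₀ C₀ ∧
      IsMaximalTrioIn H A₀ (B₀ ∩ H) (C₀ ∩ H) ∧ A₀.Nonempty ∧ (B₀ ∩ H).Nonempty ∧
      (C₀ ∩ H).Nonempty ∧ trioDeficiencyIn H A₀ (B₀ ∩ H) (C₀ ∩ H) = trioDeficiency A B C := by
  obtain ⟨A₀, B₀, C₀, h₀, hsim⟩ := h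
  have hmax₀ : IsMaximalTrio A₀ B₀ C₀ := hsim.isMaximalTrio_iff.2 hmax
  have hA₀ : A₀.Nonempty := (hsim.nonempty_iff.2 ⟨hA, hB, hC⟩).1
  obtain ⟨h1, h2, h3, h4, h5⟩ := h₀.continuation hH hmax₀ hA₀
  exact ⟨A₀, B₀, C₀, hsim, h₀, h1, h2, h3, h4, by rw [h5, hsim.trioDeficiency_eq]⟩

/-- The continuation remark for the similarity-closed notion `IsImpureChord` (Definition 4.4 as
printed): a maximal impure chord `Υ` relative to `H` is similar to a trio `(A₀,B₀,C₀)` in normal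
position whose continuation `(A₀ ∩ H, B₀ ∩ H, C₀ ∩ H)` is a nontrivial maximal trio in `H` with
`δ_H = δ(Υ)`. [cite: BoothbyDevosMontejano2013, §4] -/
theorem IsImpureChord.exists_continuation (hH : IsSubgroupCarrier H)
    (h : IsImpureChord H (A, B, C)) (hmax : IsMaximalTrio A B C) :
    ∃ r : G, ∃ A₀ B₀ C₀ : Finset G, Similar (A₀, B₀, C₀) (A, B, C) ∧ IsImpureChordAt H r A₀ B₀ C₀ ∧
      IsMaximalTrioIn H (A₀ ∩ H) (B₀ ∩ H) (C₀ ∩ H) ∧ (A₀ ∩ H).Nonempty ∧ (B₀ ∩ H).Nonempty ∧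
      (C₀ ∩ H).Nonempty ∧
      trioDeficiencyIn H (A₀ ∩ H) (B₀ ∩ H) (C₀ ∩ H) = trioDeficiency A B C := by
  obtain ⟨r, A₀, B₀, C₀, h₀, hsim⟩ := h
  have hmax₀ : IsMaximalTrio A₀ B₀ C₀ := hsim.isMaximalTrio_iff.2 hmax
  obtain ⟨h1, h2, h3, h4, h5⟩ := h₀.continuation hH hmax₀
  exact ⟨r, A₀, B₀, C₀, hsim, h₀, h1, h2, h3, h4, by rw [h5, hsim.trioDeficiency_eq]⟩

/-- The impure structures are critical too when maximal and nontrivial is assumed — conversely, by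
beat stability (Lemma 5.3 / `IsMaximalTrio.isPureBeatAt_or_isImpureBeat`), a maximal nontrivial
critical trio whose first member has closure coset `H ⊇ A` IS a pure beat or an impure beat relative
to `H`, for the similarity-closed notions. [cite: BoothbyDevosMontejano2013, Lemma 5.3; §4] -/
theorem IsMaximalTrio.isPureBeat_or_isImpureBeat (h : IsMaximalTrio A B C)
    (hδ : 0 < trioDeficiency A B C) (hA : A.Nonempty) (hB : B.Nonempty) (hC : C.Nonempty)
    (hH : IsSubgroupCarrier H) (hcl : ClosureIs H A) (hAH : A ⊆ H) :
    IsPureBeat H (A, B, C) ∨ IsImpureBeat H (A, B, C) := by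
  rcases h.isPureBeatAt_or_isImpureBeat hδ hA hB hC hH hcl hAH with h1 | h2
  · exact Or.inl ⟨A, B, C, h1, Similar.refl _⟩
  · exact Or.inr h2

end UpToSimilarity

end Literature.Combinatorics.Additive
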